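import Literature.NumberTheory.Automorphic.OrbitalMeasureCanonical
import HarnessLib

/-!
# Canonically normalised Haar measures on tori correspond under isomorphisms:
# `t(compactCore Z) = 1 = t′(compactCore Z′)` and `e : Z ≃ₜ* Z′` ⇒ `e_* t = t′`
(Rogawski (1990), §4.3 p. 43: «the Haar measures on stably conjugate tori are chosen compatibly»; Langlands–Shelstad (1987) §1.3)

Topic `NumberTheory/Automorphic`; THEOREMS ONLY (no definition, no instance, no named fact).  ★ `OrbitalMeasureCanonical` normalises the torus
measures of a CANONICAL orbital-measure family by `t(compactCore Z) = 1` (mass one on the union of the compact subgroups — the maximal compact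
subgroup of a non-archimedean torus, compact OPEN) and proves the compact core intrinsic (★ `image_compactCore`).  Consequence (this file): two
such measures on isomorphic topological groups CORRESPOND under the isomorphism — the input «`map e t_γ = t_{γ′}`» of the covolume transport
★ `covolume_count_eq_of_mulEquiv′` along ★ `adelicStableCentralizerEquiv` ((O-W): the orbital weights are constant on regular stable classes).

* `haar_eq_of_apply_eq_of_isCompact_isOpen` — two Haar measures agreeing on one compact open non-empty set are equal;
* **`map_eq_of_apply_compactCore_eq_one`** — for `e : Z ≃ₜ* Z′` and Haar measures `t`, `t′` with `t(compactCore Z) = 1`, `t′(compactCore Z′) = 1`, and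
  `compactCore Z′` compact and open: `Measure.map e t = t′`.

## References
* J. D. Rogawski, *Automorphic Representations of Unitary Groups in Three Variables* (1990), §4.3 p. 43 [Rogawski1990].
* R. P. Langlands, D. Shelstad, *On the definition of transfer factors*, Math. Ann. 278 (1987), §1.3 [LanglandsShelstad1987].
-/

set_option autoImplicit false

noncomputable section

open _root_.MeasureTheory _root_.MeasureTheory.Measure Set Filter Function
open _root_.Topology
open scoped ENNReal NNReal Pointwise

namespace Literature.NumberTheory.Automorphic

section HaarAgree

variable {Z : Type*} [Group Z] [TopologicalSpace Z] [IsTopologicalGroup Z] [LocallyCompactSpace Z]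
  [SecondCountableTopology Z] [MeasurableSpace Z] [BorelSpace Z]

/-- **Two Haar measures agreeing on one compact open non-empty set are equal** (Haar uniqueness, Mathlib `Measure.haarMeasure_unique`: each is
its mass on the positive compact times `haarMeasure`). [cite: Rogawski1990, §4.3 p. 43] -/
theorem haar_eq_of_apply_eq_of_isCompact_isOpen (t t' : Measure Z) [t.IsHaarMeasure] [t'.IsHaarMeasure] {C : Set Z} (hCc : IsCompact C)
    (hCo : IsOpen C) (hCne : C.Nonempty) (h : t C = t' C) : t = t' := by
  let K₀ : TopologicalSpace.PositiveCompacts Z := ⟨⟨C, hCc⟩, by rwa [hCo.interior_eq]⟩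
  have hK : (K₀ : Set Z) = C := rfl
  rw [haarMeasure_unique t K₀, haarMeasure_unique t' K₀, hK, h]

end HaarAgree

section Transport

variable {Z Z' : Type*} [Group Z] [Group Z'] [TopologicalSpace Z] [TopologicalSpace Z'] [IsTopologicalGroup Z] [IsTopologicalGroup Z']
  [LocallyCompactSpace Z'] [SecondCountableTopology Z']
  [MeasurableSpace Z] [BorelSpace Z] [MeasurableSpace Z'] [BorelSpace Z']

/-- **Canonically normalised torus measures correspond under isomorphisms of topological groups**: for `e : Z ≃ₜ* Z′`, Haar measures `t` on `Z`
and `t′` on `Z′` with `t(compactCore Z) = 1` and `t′(compactCore Z′) = 1`, and `compactCore Z′` compact and open (the non-archimedean torus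
case: the maximal compact subgroup), `e_* t = t′` — «the measures on stably conjugate tori are compatible» once both are normalised on the
maximal compact subgroups, which correspond (★ `image_compactCore`). [cite: Rogawski1990, §4.3 p. 43] [cite: LanglandsShelstad1987, §1.3] -/
theorem map_eq_of_apply_compactCore_eq_one (e : Z ≃ₜ* Z') (t : Measure Z) [t.IsHaarMeasure] (t' : Measure Z') [t'.IsHaarMeasure]
    (ht : t (compactCore Z) = 1) (ht' : t' (compactCore Z') = 1) (hc : IsCompact (compactCore Z')) (ho : IsOpen (compactCore Z')) :
    Measure.map e t = t' := by
  haveI : (Measure.map e t).IsHaarMeasure := MulEquiv.isHaarMeasure_map t e.toMulEquiv e.continuous e.symm.continuous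
  refine haar_eq_of_apply_eq_of_isCompact_isOpen _ _ hc ho ⟨1, one_mem_compactCore⟩ ?_
  have hm : Measurable (⇑e) := e.continuous.measurable
  rw [Measure.map_apply hm ho.measurableSet, ht']
  have hpre : ⇑e ⁻¹' compactCore Z' = compactCore Z := by
    rw [← image_compactCore e]; exact e.injective.preimage_image _
  rw [hpre, ht]

end Transport

end Literature.NumberTheory.Automorphic
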